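import Literature.NumberTheory.NumberFields.RelativeDifferentExponentsTower
import Mathlib.FieldTheory.Normal.Closure
import HarnessLib

/-!
# Dedekind–Hensel: the different bound `v_P(𝔇_{M/L}) ≤ e - 1 + v_P(e)` for EVERY extension of number fields

Topic `NumberTheory/NumberFields`. Theorems only (no definition, no named fact). Sequel of the tree's
`DedekindDifferentBound.lean` / `DedekindDifferentBoundRelative.lean` (the GALOIS case, Bombieri–Gubler
Thm. B.2.11) and `RelativeDifferentExponents(Tower).lean`.

For an ARBITRARY finite extension of number fields `M/L` (no normality hypothesis) and a maximal ideal `P`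
of `𝓞 M` with relative ramification index `e = e(P | P ∩ 𝓞 L)`:

  `ord_P 𝔇_{M/L} ≤ e - 1 + ord_P(e)`, stated as `P ^ j ∣ 𝔇_{M/L} → j + 1 ≤ e + multiplicity P (e)`

(Dedekind's conjecture, proved by Hensel; Serre, *Corps locaux*, Ch. III §6, Remarque after Prop. 13:
«`e - 1 ≤ v_L(𝔇) ≤ e - 1 + v_L(e)`»; Bombieri–Gubler, *Heights*, App. B, Thm. B.2.12 (b); Neukirch,
*Algebraic Number Theory*, Ch. III (2.6): «`e ≤ s ≤ e - 1 + v_𝔓(e)` if `𝔓` is wildly ramified»). Neither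
Mathlib nor the tree had the non-Galois case at this snapshot (the tree's `HenselDifferentBound.lean` is
the weaker DVR form `e - 1 + e·ord(e f)` of Javanpeykar 2014, Prop. 4.1.3).

## Proof (global; no completions)

The printed proofs complete at `P` and split off the maximal unramified subextension. Globally: embed
`M/L` in a finite Galois extension `N/L`, choose a prime `W` of `𝓞 N` above `P`, and let
`E₁ = N^{I(W|L)} ⊆ M₁ = N^{I(W|M)}` be the inertia fields of `W` over `L` and over `M` (`I(W|M) ≤ I(W|L)`).
With `W₁ = W ∩ 𝓞 M₁`, `𝔭₁ = W ∩ 𝓞 E₁`, `v = P ∩ 𝓞 L`, the inertia-group cardinalities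
(`|I(W|K)| = e(W | W ∩ K) = [N : N^{I(W|K)}]`, Mathlib `Ideal.card_inertia_eq_ramificationIdxIn`,
`IntermediateField.finrank_fixedField_eq_card`) and multiplicativity of `e` give

* `e(W₁ | P) = 1` and `e(𝔭₁ | v) = 1` (so `ord_{W₁} 𝔇_{M₁/M} = 0 = ord_{𝔭₁} 𝔇_{E₁/L}`), and
* `[M₁ : E₁] = e(W₁ | 𝔭₁) = e`.

Transitivity of the different along `L ⊆ M ⊆ M₁` and `L ⊆ E₁ ⊆ M₁` (the tree's
`multiplicity_differentIdeal_tower`) then yields `ord_P 𝔇_{M/L} = ord_{W₁} 𝔇_{M₁/E₁}` and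
`ord_{W₁}(e) = ord_P(e)`, and the totally ramified monogenic computation of `DedekindDifferentBound.lean`
(a uniformiser `π` at `W₁` generates `M₁/E₁` because `[M₁:E₁] = e(W₁|𝔭₁)`; `f'(π) ∈ 𝔇_{M₁/E₁}` by Mathlib's
`aeval_derivative_mem_differentIdeal`; `ord_{W₁} f'(π) ≤ e - 1 + ord_{W₁}(e)` by the tree's
`intValuation_term_le_sum`) finishes: `succ_le_of_pow_dvd_differentIdeal_of_finrank_eq_ramificationIdx`.

## Main statements

* `succ_le_of_pow_dvd_differentIdeal_of_finrank_eq_ramificationIdx` — the monogenic core: `[F:E] = e(Q|q)`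
  ⟹ `Q ^ j ∣ 𝔇_{F/E} → j + 1 ≤ e + ord_Q(e)`;
* `succ_le_ramificationIdx_add_multiplicity_of_pow_dvd_differentIdeal_of_tower` — `M/L` inside a Galois
  `N/L`;
* `succ_le_ramificationIdx_add_multiplicity_of_pow_dvd_differentIdeal_general` and
  `multiplicity_differentIdeal_succ_le` — every `M/L` (via Mathlib's `normalClosure`).

## References

* [SerreLocalFields1979] J.-P. Serre, *Local Fields*, GTM 67, Ch. III §6, Prop. 13 and Remark.
* [BombieriGubler2006] E. Bombieri, W. Gubler, *Heights in Diophantine Geometry*, CUP 2006, App. B,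
  Thm. B.2.12.
* [NeukirchANT1999] J. Neukirch, *Algebraic Number Theory*, Springer 1999, Ch. III, Thm. (2.6).
-/

noncomputable section

open IsDedekindDomain NumberField Polynomial WithZero
open scoped IntermediateField

namespace Literature.NumberTheory.NumberFields

/-! ## The monogenic core: `[F : E] = e(Q | q)` -/

/-- **Core of the Dedekind–Hensel bound.** Let `F/E` be an extension of number fields and `Q` a non-zero
prime of `𝓞 F` whose ramification index `e = e(Q | Q ∩ 𝓞 E)` EQUALS the degree `[F : E]` (so `Q` is the
only prime above `q = Q ∩ 𝓞 E`, totally ramified, residue degree `1`). Then `Q ^ j ∣ 𝔇_{F/E}` implies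
`j + 1 ≤ e + ord_Q(e)`. Proof: a uniformiser `π` at `Q` has minimal polynomial `f` over `𝓞 E` of degree
`≤ [F:E] = e`, and `= e` by the Eisenstein-type valuation computation (`intValuation_term_le_sum`), so
`F = E(π)`, `f'(π) ∈ 𝔇_{F/E}` (Mathlib `aeval_derivative_mem_differentIdeal`) and
`ord_Q f'(π) ≤ ord_Q(e·π^{e-1}) = e - 1 + ord_Q(e)`. [cite: SerreLocalFields1979, Ch. III §6 Prop. 13, Remark] -/
theorem succ_le_of_pow_dvd_differentIdeal_of_finrank_eq_ramificationIdx
    (E F : Type*) [Field E] [NumberField E] [Field F] [NumberField F] [Algebra E F]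
    (Q : Ideal (𝓞 F)) [Q.IsPrime] (hQ : Q ≠ ⊥)
    (hdeg : Module.finrank E F = Q.ramificationIdx (𝓞 E)) {j : ℕ}
    (hj : Q ^ j ∣ differentIdeal (𝓞 E) (𝓞 F)) :
    j + 1 ≤ Q.ramificationIdx (𝓞 E) +
      multiplicity Q (Ideal.span {((Q.ramificationIdx (𝓞 E) : ℕ) : 𝓞 F)}) := by
  classical
  set e := Q.ramificationIdx (𝓞 E) with he
  have he0 : e ≠ 0 := (Ideal.ramificationIdx_pos Q (𝓞 E)).ne'
  let C := 𝓞 E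
  let 𝔮 : Ideal C := Q.under C
  -- valuations
  let w : HeightOneSpectrum (𝓞 F) := ⟨Q, inferInstance, hQ⟩
  obtain ⟨π, hπ⟩ := w.intValuation_exists_uniformizer
  have h𝔮bot : 𝔮 ≠ ⊥ := Ideal.under_ne_bot C hQ
  let v : HeightOneSpectrum C := ⟨𝔮, inferInstance, h𝔮bot⟩
  have hvw : w.asIdeal.LiesOver v.asIdeal := inferInstanceAs (Q.LiesOver 𝔮)
  have he' : v.asIdeal.ramificationIdx' w.asIdeal = e :=
    Ideal.ramificationIdx'_eq_ramificationIdx 𝔮 Q h𝔮bot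
  -- the minimal polynomial of `π` over `C` has degree `e` (`π` generates `F` over `E`)
  have hπint : IsIntegral C π := Algebra.IsIntegral.isIntegral π
  set f := minpoly C π with hf
  have hfm : f.Monic := minpoly.monic hπint
  have hπF : IsIntegral E (π : F) := Algebra.IsIntegral.isIntegral _
  have hfF : minpoly E (π : F) = f.map (algebraMap C E) := by
    rw [minpoly.isIntegrallyClosed_eq_field_fractions' E (hπint.algebraMap (B := F)), hf,
      minpoly.algebraMap_eq (FaithfulSMul.algebraMap_injective (𝓞 F) F)]
  have hfinrank : Module.finrank E E⟮(π : F)⟯ = f.natDegree := by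
    rw [IntermediateField.adjoin.finrank hπF, hfF,
      natDegree_map_eq_of_injective (FaithfulSMul.algebraMap_injective C E)]
  have heF : Module.finrank E F = e := hdeg
  have hdeg_le : f.natDegree ≤ e := by
    rw [← hfinrank, ← heF]
    exact Module.finrank_bot_le_finrank_of_isScalarTower E E⟮(π : F)⟯ F
  -- expansion of `aeval π g` for a polynomial `g` over `C`
  have hexp : ∀ (g : C[X]) (n : ℕ), g.natDegree < n →
      aeval π g = ∑ k ∈ Finset.range n, algebraMap C (𝓞 F) (g.coeff k) * π ^ k := by
    intro g n hn
    rw [aeval_eq_sum_range' hn]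
    simp_rw [Algebra.smul_def]
  have hdegf : f.natDegree = e := by
    refine le_antisymm hdeg_le (not_lt.mp fun hlt => ?_)
    have hsum : ∑ k ∈ Finset.range (f.natDegree + 1),
        algebraMap C (𝓞 F) (f.coeff k) * π ^ k = 0 := by
      rw [← hexp f (f.natDegree + 1) (Nat.lt_succ_self _), hf, minpoly.aeval]
    have key := intValuation_term_le_sum v w hπ (n := f.natDegree + 1)
      (by rw [he']; exact hlt) (fun k => f.coeff k) (k₁ := f.natDegree) (Nat.lt_succ_self _)
      (by rw [hfm.coeff_natDegree]; exact one_ne_zero)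
    rw [hsum, map_zero, le_zero_iff, hfm.coeff_natDegree, map_one, one_mul, map_pow, hπ,
      ← exp_nsmul] at key
    exact exp_ne_zero key
  have htop' : E⟮(π : F)⟯ = ⊤ :=
    IntermediateField.eq_of_le_of_finrank_eq le_top
      (by rw [hfinrank, hdegf, IntermediateField.finrank_top', heF])
  have hadj : Algebra.adjoin E {(π : F)} = ⊤ := by
    rw [← IntermediateField.adjoin_simple_toSubalgebra_of_isAlgebraic hπF.isAlgebraic, htop',
      IntermediateField.top_toSubalgebra]
  have hmem : aeval π (derivative f) ∈ differentIdeal C (𝓞 F) :=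
    aeval_derivative_mem_differentIdeal C E F π hadj
  -- the derivative, expanded
  have he1 : e - 1 + 1 = e := Nat.sub_add_cancel (Nat.one_le_iff_ne_zero.mpr he0)
  have hder : aeval π (derivative f) =
      ∑ k ∈ Finset.range e, algebraMap C (𝓞 F) (f.coeff (k + 1) * (k + 1 : ℕ)) * π ^ k := by
    rw [hexp (derivative f) e (lt_of_lt_of_le (natDegree_derivative_lt (hdegf ▸ he0)) hdegf.le)]
    refine Finset.sum_congr rfl fun k _ => ?_
    rw [coeff_derivative]
    push_cast
    ring
  have hcoef : f.coeff (e - 1 + 1) * ((e - 1 : ℕ) + 1 : ℕ) = (e : C) := by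
    rw [he1, ← hdegf, hfm.coeff_natDegree, one_mul]
  have hterm := intValuation_term_le_sum v w hπ (n := e) he'.ge
    (fun k => f.coeff (k + 1) * (k + 1 : ℕ)) (k₁ := e - 1) (by omega)
    (by rw [hcoef]; exact_mod_cast he0)
  rw [← hder, hcoef, map_natCast] at hterm
  -- `hterm : w (e * π^(e-1)) ≤ w (f'(π))`; divisibility
  have hjf : Q ^ j ∣ Ideal.span {aeval π (derivative f)} :=
    hj.trans (Ideal.dvd_iff_le.mpr ((Ideal.span_singleton_le_iff_mem _).mpr hmem))
  have hwj : w.intValuation (aeval π (derivative f)) ≤ exp (-(j : ℤ)) :=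
    (w.intValuation_le_pow_iff_dvd _ j).mpr hjf
  -- conclusion
  have hfin := hterm.trans hwj
  have he0' : ((e : ℕ) : 𝓞 F) ≠ 0 := by exact_mod_cast he0
  rw [map_mul, map_pow, hπ, w.intValuation_eq_exp_neg_multiplicity he0', ← exp_nsmul, ← exp_add,
    exp_le_exp] at hfin
  simp only [smul_neg, nsmul_eq_mul, mul_one] at hfin
  have hQw : multiplicity w.asIdeal (Ideal.span {((e : ℕ) : 𝓞 F)}) =
      multiplicity Q (Ideal.span {((e : ℕ) : 𝓞 F)}) := rfl
  rw [hQw] at hfin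
  change j + 1 ≤ e + multiplicity Q (Ideal.span {((e : ℕ) : 𝓞 F)})
  clear_value e
  omega

/-! ## Inside a Galois extension: the two inertia fields -/

/-- **Dedekind–Hensel inside a Galois extension.** Let `L ⊆ M ⊆ N` be number fields with `N/L` Galois,
`P` a maximal ideal of `𝓞 M` with `e = e(P | P ∩ 𝓞 L)`. If `P ^ j ∣ 𝔇_{M/L}` then `j + 1 ≤ e + ord_P(e)`.
Proof: see the module docstring (inertia fields `E₁ = N^{I(W|L)} ⊆ M₁ = N^{I(W|M)}` of a prime `W ∣ P` of
`𝓞 N`, `e(W₁|P) = e(𝔭₁|v) = 1`, `[M₁ : E₁] = e(W₁|𝔭₁) = e`, transitivity of the different, and the monogenic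
core `succ_le_of_pow_dvd_differentIdeal_of_finrank_eq_ramificationIdx`).
[cite: SerreLocalFields1979, Ch. III §6 Prop. 13, Remark] -/
theorem succ_le_ramificationIdx_add_multiplicity_of_pow_dvd_differentIdeal_of_tower
    (L M N : Type*) [Field L] [NumberField L] [Field M] [NumberField M] [Field N] [NumberField N]
    [Algebra L M] [Algebra M N] [Algebra L N] [IsScalarTower L M N] [IsGalois L N]
    (P : Ideal (𝓞 M)) [P.IsMaximal] {j : ℕ} (hj : P ^ j ∣ differentIdeal (𝓞 L) (𝓞 M)) :
    j + 1 ≤ P.ramificationIdx (𝓞 L) +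
      multiplicity P (Ideal.span {((P.ramificationIdx (𝓞 L) : ℕ) : 𝓞 M)}) := by
  classical
  set e := P.ramificationIdx (𝓞 L) with he
  have he0 : e ≠ 0 := (Ideal.ramificationIdx_pos P (𝓞 L)).ne'
  have hP : P ≠ ⊥ := Ideal.IsMaximal.ne_bot_of_isIntegral_int P
  -- a prime `W` of `𝓞 N` above `P`
  obtain ⟨W, hWmax, hWP⟩ := Ideal.exists_maximal_ideal_liesOver_of_isIntegral (S := 𝓞 N) P
  have hW : W ≠ ⊥ := Ideal.IsMaximal.ne_bot_of_isIntegral_int W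
  have hWunder : W.under (𝓞 M) = P := hWP.over.symm
  /- ### the inertia field `E₁` of `W` over `L` -/
  let G := N ≃ₐ[L] N
  have : IsGaloisGroup G (𝓞 L) (𝓞 N) := IsGaloisGroup.of_isFractionRing G (𝓞 L) (𝓞 N) L N
  let I : Subgroup G := W.inertia G
  let E₁ : IntermediateField L N := IntermediateField.fixedField I
  let C := 𝓞 E₁
  have hE₁ : Module.finrank E₁ N = Nat.card I := IntermediateField.finrank_fixedField_eq_card I
  let v₀ : Ideal (𝓞 L) := W.under (𝓞 L)
  have hIcard : Nat.card I = v₀.ramificationIdxIn (𝓞 N) :=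
    Ideal.card_inertia_eq_ramificationIdxIn (G := G) v₀ W
  have heeN := Ideal.ramificationIdxIn_eq_ramificationIdx v₀ W G
  let H := N ≃ₐ[E₁] N
  have : IsGaloisGroup H C (𝓞 N) := IsGaloisGroup.of_isFractionRing H C (𝓞 N) E₁ N
  let 𝔭₁ : Ideal C := W.under C
  have hcardH := Ideal.card_inertia_eq_ramificationIdxIn (G := H) 𝔭₁ W
  have htop : W.inertia H = ⊤ := by
    rw [eq_top_iff]
    intro τ _
    refine AddSubgroup.mem_inertia.mpr fun x => ?_
    have hτ : τ.restrictScalars L ∈ I := by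
      rw [← IntermediateField.fixingSubgroup_fixedField I]
      intro y
      exact τ.commutes y
    exact AddSubgroup.mem_inertia.mp hτ x
  rw [htop, Ideal.ramificationIdxIn_eq_ramificationIdx 𝔭₁ W H] at hcardH
  have h1 : Nat.card (⊤ : Subgroup H) = Nat.card H := Nat.card_congr Subgroup.topEquiv.toEquiv
  rw [h1, IsGaloisGroup.card_eq_finrank H E₁ N, hE₁, hIcard, heeN] at hcardH
  -- `hcardH : W.ramificationIdx (𝓞 L) = W.ramificationIdx C`
  have hfinE₁ : Module.finrank E₁ N = W.ramificationIdx (𝓞 L) := by rw [hE₁, hIcard, heeN]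
  /- ### the inertia field `M₁` of `W` over `M` -/
  haveI := hWP
  haveI : IsGalois M N := IsGalois.tower_top_of_isGalois L M N
  let G' := N ≃ₐ[M] N
  have : IsGaloisGroup G' (𝓞 M) (𝓞 N) := IsGaloisGroup.of_isFractionRing G' (𝓞 M) (𝓞 N) M N
  let I' : Subgroup G' := W.inertia G'
  let M₁ : IntermediateField M N := IntermediateField.fixedField I'
  let C₁ := 𝓞 M₁
  have hM₁ : Module.finrank M₁ N = Nat.card I' := IntermediateField.finrank_fixedField_eq_card I'
  have hI'card : Nat.card I' = P.ramificationIdxIn (𝓞 N) :=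
    Ideal.card_inertia_eq_ramificationIdxIn (G := G') P W
  have hee' := Ideal.ramificationIdxIn_eq_ramificationIdx P W G'
  let H' := N ≃ₐ[M₁] N
  have : IsGaloisGroup H' C₁ (𝓞 N) := IsGaloisGroup.of_isFractionRing H' C₁ (𝓞 N) M₁ N
  let W₁ : Ideal C₁ := W.under C₁
  have hcardH' := Ideal.card_inertia_eq_ramificationIdxIn (G := H') W₁ W
  have htop' : W.inertia H' = ⊤ := by
    rw [eq_top_iff]
    intro τ _
    refine AddSubgroup.mem_inertia.mpr fun x => ?_
    have hτ : τ.restrictScalars M ∈ I' := by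
      rw [← IntermediateField.fixingSubgroup_fixedField I']
      intro y
      exact τ.commutes y
    exact AddSubgroup.mem_inertia.mp hτ x
  rw [htop', Ideal.ramificationIdxIn_eq_ramificationIdx W₁ W H'] at hcardH'
  have h1' : Nat.card (⊤ : Subgroup H') = Nat.card H' := Nat.card_congr Subgroup.topEquiv.toEquiv
  rw [h1', IsGaloisGroup.card_eq_finrank H' M₁ N, hM₁, hI'card, hee'] at hcardH'
  -- `hcardH' : W.ramificationIdx (𝓞 M) = W.ramificationIdx C₁`
  have hfinM₁ : Module.finrank M₁ N = W.ramificationIdx (𝓞 M) := by rw [hM₁, hI'card, hee']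
  /- ### `E₁ ⊆ M₁`, and the algebra structure -/
  have hle : E₁ ≤ M₁.restrictScalars L := by
    intro x hx
    rw [IntermediateField.mem_restrictScalars]
    refine (IntermediateField.mem_fixedField_iff I' x).mpr fun τ hτ => ?_
    have hτ' : τ.restrictScalars L ∈ I :=
      AddSubgroup.mem_inertia.mpr fun y => AddSubgroup.mem_inertia.mp hτ y
    exact (IntermediateField.mem_fixedField_iff I x).mp hx _ hτ'
  let ι : E₁ →ₐ[L] (M₁.restrictScalars L) := IntermediateField.inclusion hle
  letI : Algebra E₁ M₁ := (ι.toRingHom : E₁ →+* M₁).toAlgebra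
  haveI : IsScalarTower E₁ M₁ N := IsScalarTower.of_algebraMap_eq fun x => rfl
  haveI : IsScalarTower L E₁ M₁ := IsScalarTower.of_algebraMap_eq fun x => Subtype.ext rfl
  /- ### numerology of ramification indices -/
  have he'0 : W.ramificationIdx (𝓞 M) ≠ 0 := (Ideal.ramificationIdx_pos W (𝓞 M)).ne'
  -- `e(W|v) = e(P|v) · e(W|P)` along `𝓞 L ⊆ 𝓞 M ⊆ 𝓞 N`
  have htowerLMN : W.ramificationIdx (𝓞 L) = e * W.ramificationIdx (𝓞 M) :=
    Ideal.ramificationIdx_tower (R := 𝓞 L) P W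
  -- `[M₁ : E₁] = e`
  haveI : Module.Free E₁ M₁ := Module.Free.of_divisionRing E₁ M₁
  have hfinEM : Module.finrank E₁ M₁ = e := by
    have h := Module.finrank_mul_finrank E₁ M₁ N
    rw [hfinE₁, hfinM₁, htowerLMN] at h
    exact mul_right_cancel₀ he'0 h
  -- `W₁ = W ∩ 𝓞 M₁` lies over `P` and over `𝔭₁`; `e(W₁ | P) = 1`, `e(W₁ | 𝔭₁) = e`, `e(𝔭₁ | v) = 1`
  haveI : W₁.IsMaximal := Ideal.IsMaximal.under C₁ W
  haveI : 𝔭₁.IsMaximal := Ideal.IsMaximal.under C W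
  have hW₁P : W₁.under (𝓞 M) = P := by rw [Ideal.under_under, hWunder]
  have hW₁𝔭 : W₁.under C = 𝔭₁ := by
    show (W.under C₁).under C = W.under C
    exact Ideal.under_under W
  haveI : W₁.LiesOver P := ⟨hW₁P.symm⟩
  haveI : W₁.LiesOver 𝔭₁ := ⟨hW₁𝔭.symm⟩
  have hramW₁P : W₁.ramificationIdx (𝓞 M) = 1 := by
    have h := Ideal.ramificationIdx_tower (R := 𝓞 M) W₁ W
    -- h : W.ramificationIdx (𝓞 M) = W₁.ramificationIdx (𝓞 M) * W.ramificationIdx C₁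
    rw [← hcardH'] at h
    exact (mul_eq_right₀ he'0).mp h.symm
  have hramW₁𝔭 : W₁.ramificationIdx C = e := by
    have h := Ideal.ramificationIdx_tower (R := C) W₁ W
    -- h : W.ramificationIdx C = W₁.ramificationIdx C * W.ramificationIdx C₁
    rw [← hcardH, ← hcardH', htowerLMN] at h
    exact (mul_right_cancel₀ he'0 h).symm
  have hram𝔭v : 𝔭₁.ramificationIdx (𝓞 L) = 1 := by
    have h := Ideal.ramificationIdx_tower (R := 𝓞 L) 𝔭₁ W
    -- h : W.ramificationIdx (𝓞 L) = 𝔭₁.ramificationIdx (𝓞 L) * W.ramificationIdx C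
    rw [← hcardH] at h
    have heN0 : W.ramificationIdx (𝓞 L) ≠ 0 := (Ideal.ramificationIdx_pos W (𝓞 L)).ne'
    exact (mul_eq_right₀ heN0).mp h.symm
  /- ### transfer of the exponent along `L ⊆ M ⊆ M₁` and `L ⊆ E₁ ⊆ M₁` -/
  have htLM : multiplicity W₁ (differentIdeal (𝓞 L) C₁) =
      multiplicity P (differentIdeal (𝓞 L) (𝓞 M)) := by
    rw [multiplicity_differentIdeal_tower L M M₁ W₁,
      multiplicity_differentIdeal_eq_zero_of_ramificationIdx_eq_one M M₁ W₁ hramW₁P, hramW₁P, one_mul,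
      zero_add, hW₁P]
  have htLE : multiplicity W₁ (differentIdeal (𝓞 L) C₁) = multiplicity W₁ (differentIdeal C C₁) := by
    rw [multiplicity_differentIdeal_tower L E₁ M₁ W₁, hW₁𝔭,
      multiplicity_differentIdeal_eq_zero_of_ramificationIdx_eq_one L E₁ 𝔭₁ hram𝔭v, mul_zero, add_zero]
  -- `ord_{W₁}(e) = ord_P(e)`: both are `e(· | p) · v_p(e)` with the same residue characteristic and `e(W₁|P) = 1`
  have hspan : multiplicity W₁ (Ideal.span {((e : ℕ) : C₁)}) = multiplicity P (Ideal.span {((e : ℕ) : 𝓞 M)}) := by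
    rw [multiplicity_span_natCast M₁ W₁ he0, multiplicity_span_natCast M P he0,
      Ideal.ramificationIdx_tower (R := ℤ) P W₁, hramW₁P, mul_one]
    have : W₁.under ℤ = P.under ℤ := by
      show (W.under C₁).under ℤ = P.under ℤ
      rw [Ideal.under_under, ← hWunder, Ideal.under_under]
    rw [this]
  /- ### the monogenic core at `W₁` for `M₁ / E₁` -/
  have hW₁ : W₁ ≠ ⊥ := Ideal.IsMaximal.ne_bot_of_isIntegral_int W₁
  have hcore := succ_le_of_pow_dvd_differentIdeal_of_finrank_eq_ramificationIdx E₁ M₁ W₁ hW₁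
    (hfinEM.trans hramW₁𝔭.symm) (pow_multiplicity_dvd W₁ (differentIdeal C C₁))
  rw [hramW₁𝔭, hspan, ← htLE, htLM] at hcore
  -- `j ≤ ord_P 𝔇_{M/L}`
  have hD : differentIdeal (𝓞 L) (𝓞 M) ≠ ⊥ := differentIdeal_ne_bot
  have hjle : j ≤ multiplicity P (differentIdeal (𝓞 L) (𝓞 M)) :=
    (FiniteMultiplicity.of_prime_left (Ideal.prime_of_isPrime hP inferInstance) hD).le_multiplicity_of_pow_dvd hj
  omega

/-! ## Every extension of number fields -/

/-- **Dedekind–Hensel, general form (divisibility statement).** For EVERY extension of number fields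
`M/L` and every maximal ideal `P` of `𝓞 M` with `e = e(P | P ∩ 𝓞 L)`: `P ^ j ∣ 𝔇_{M/L} → j + 1 ≤ e + ord_P(e)`
(no normality hypothesis; via the normal closure of `M/L` in an algebraic closure and
`succ_le_ramificationIdx_add_multiplicity_of_pow_dvd_differentIdeal_of_tower`).
[cite: SerreLocalFields1979, Ch. III §6 Prop. 13, Remark] -/
theorem succ_le_ramificationIdx_add_multiplicity_of_pow_dvd_differentIdeal_general
    (L M : Type*) [Field L] [NumberField L] [Field M] [NumberField M] [Algebra L M]
    (P : Ideal (𝓞 M)) [P.IsMaximal] {j : ℕ} (hj : P ^ j ∣ differentIdeal (𝓞 L) (𝓞 M)) :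
    j + 1 ≤ P.ramificationIdx (𝓞 L) +
      multiplicity P (Ideal.span {((P.ramificationIdx (𝓞 L) : ℕ) : 𝓞 M)}) := by
  let A := AlgebraicClosure M
  let N : IntermediateField L A := IntermediateField.normalClosure L M A
  haveI : FiniteDimensional L N := normalClosure.is_finiteDimensional L M A
  haveI : NumberField N := NumberField.of_module_finite L N
  haveI : IsGalois L N := IsGalois.mk
  exact succ_le_ramificationIdx_add_multiplicity_of_pow_dvd_differentIdeal_of_tower L M N P hj

/-- **Dedekind–Hensel, general form (exponent statement): `ord_P 𝔇_{M/L} ≤ e - 1 + ord_P(e)`**, i.e.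
`multiplicity P 𝔇_{M/L} + 1 ≤ e + multiplicity P (e)`, for every extension of number fields `M/L` and every
maximal `P ⊂ 𝓞 M` (the non-Galois companion of the tree's `multiplicity_differentIdeal_succ_le_of_isGalois`;
together with `ramificationIdx_sub_one_le_multiplicity_differentIdeal` this is Neukirch III (2.6)
«`e - 1 ≤ s ≤ e - 1 + v_𝔓(e)`»). [cite: NeukirchANT1999, Ch. III (2.6)] -/
theorem multiplicity_differentIdeal_succ_le
    (L M : Type*) [Field L] [NumberField L] [Field M] [NumberField M] [Algebra L M]
    (P : Ideal (𝓞 M)) [P.IsMaximal] :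
    multiplicity P (differentIdeal (𝓞 L) (𝓞 M)) + 1 ≤ P.ramificationIdx (𝓞 L) +
      multiplicity P (Ideal.span {((P.ramificationIdx (𝓞 L) : ℕ) : 𝓞 M)}) :=
  succ_le_ramificationIdx_add_multiplicity_of_pow_dvd_differentIdeal_general L M P
    (pow_multiplicity_dvd _ _)

/-- **Wild upper bound in absolute terms: `ord_P 𝔇_{M/L} + 1 ≤ e(P|p) · (v_p(e) + 1)`** — with `p` the residue
characteristic, `e(P|p)` the absolute ramification index and `e = e(P | P ∩ 𝓞 L) ≤ e(P|p)` (from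
`ord_P((e)) = e(P|p)·v_p(e)`, the tree's `multiplicity_span_natCast`). [cite: NeukirchANT1999, Ch. III (2.6)] -/
theorem multiplicity_differentIdeal_lt_absolute
    (L M : Type*) [Field L] [NumberField L] [Field M] [NumberField M] [Algebra L M]
    (P : Ideal (𝓞 M)) [P.IsMaximal] :
    multiplicity P (differentIdeal (𝓞 L) (𝓞 M)) + 1 ≤
      P.ramificationIdx ℤ * ((P.ramificationIdx (𝓞 L)).factorization (Ideal.absNorm (P.under ℤ)) + 1) := by
  have h1 := multiplicity_differentIdeal_succ_le L M P
  have he0 : P.ramificationIdx (𝓞 L) ≠ 0 := (Ideal.ramificationIdx_pos P (𝓞 L)).ne'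
  rw [multiplicity_span_natCast M P he0] at h1
  have h3 := Nat.le_of_dvd (Ideal.ramificationIdx_pos P ℤ) (ramificationIdx_rel_dvd_ramificationIdx_int L M P)
  nlinarith

end Literature.NumberTheory.NumberFields
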